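import Mathlib
import Summits.KontsevichZagierPeriods.Zeta5Search.Families.MomentAsymptotics
import Summits.KontsevichZagierPeriods.Zeta5Search.Families.PowProdBounded
import HarnessLib

/-!
# ζ(5) search — Families: the growth constant of a generalised cellular family along an exponent RAY

HONEST FRAMING: systematic search; no irrationality claim unless certified.  STRUCTURAL facts about the size of
Brown's generalised cellular integrals `I_σ(a,b) = ∫_{S_n} f_σ(a,b) ω_σ` [Brown2016, §1.5 (1.4), §5.1–5.2] along a
ray of exponents `(a,b) = (N·α, N·β)`, `N ∈ ℕ` — the shape of EVERY one-parameter family the designers use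
(Brown–Zudilin's 8-parameter `₈π₈^∨` integrals, Brown's `N = 5, 6, 8` examples, the VIM/`π¹⁰_odd` rays are all of
this form); nothing about the arithmetic of any zeta value.  Seat P2, Families layer; sequel of
`Families/BasicGrowth.lean` (the basic ray `α = β = 1`).

For a bijective seating `σ`, integer directions `α, β` satisfying Brown's homogeneity (5.2), put
`F = f_σ(α,β) = ∏_i (z_i − z_{i+1})^{α_i} / ∏_i (z_{σ_i} − z_{σ_{i+1}})^{β_i}` (`rayF`, finite factors) so that
`f_σ(Nα,Nβ) ω_σ = F^N · ω_σ` (`integrand_ray_eq`), and **`M_σ(α,β) := sup_S F`** (`raySup`).  Suppose the whole ray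
lies in Brown's convergence cone: `BrownConvergent σ (N·α) (N·β)` for all `N ≥ 0` (for convergent `σ` this is the
finite set of chord inequalities `slope ≥ 0`, `brownConvergent_ray_iff`).  PROVED:
* `rayExpSum_nonneg_of_ray` — every run of consecutive gaps carries a non-negative `F`-exponent sum (Archimedes on
  the block criterion `Crit` of all `N`; the full run has sum `0` by the homogeneity identity `twoOrdSet_eq_two_mul`),
  hence **`rayF_le_Kup`: `F` is BOUNDED on the open simplex** (`Families/PowProdBounded.lean`), `raySup_pos`;
* **`tendsto_integral_ray_root`** — `I_σ(Nα,Nβ)^{1/N} → M_σ(α,β)`; `tendsto_log_integral_ray_div`;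
  `integral_ray_le_raySup_pow` (`I(N) ≤ M^N I(0)`); `integral_ray_sq_le_mul` (log-convexity),
  `integral_ray_ratio_mono`, `integral_ray_ratio_le_raySup`, **`tendsto_integral_ray_ratio`** (`I(N+1)/I(N) ↑ M`) —
  all from the abstract engine `Families/MomentAsymptotics.lean`.
So the size of every cellular family on a convergent ray is `M_σ(α,β)^{N+o(N)}` with `M` a variational number, and every
exactly computed ratio `I(N+1)/I(N)` certifies `M ≥` that ratio.  Standard axioms only.
-/

noncomputable section

open MeasureTheory Set Finset Filter Topology

namespace Summit.KontsevichZagierPeriods.Zeta5Search.Families.Cellular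

variable {ℓ : ℕ} (σ : Fin (ℓ + 3) → Fin (ℓ + 3)) (α β : Fin (ℓ + 3) → ℤ)

/-! ### The ray function `F = f_σ(α,β)` and the factorisation `f_σ(Nα,Nβ) ω_σ = F^N ω_σ` -/

/-- Brown's function `f_σ(α,β) = ∏_i (z_i − z_{i+1})^{α_i} / ∏_i (z_{σ_i} − z_{σ_{i+1}})^{β_i}` (finite factors) in
simplicial coordinates — the base of the ray `N ↦ f_σ(Nα,Nβ) ω_σ = f_σ(α,β)^N ω_σ`. [Brown2016, §5.2 (5.4)] -/
def rayF (t : Fin ℓ → ℝ) : ℝ := num α t / den σ β t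

/-- **The growth constant of the ray** `(α, β)`: `M_σ(α,β) = sup_S f_σ(α,β)` over the open simplex. [structural] -/
def raySup : ℝ := sSup (rayF σ α β '' openSimplex ℓ)

/-- `num (N·α) = (num α)^N`. -/
theorem num_ray (N : ℕ) (t : Fin ℓ → ℝ) : num (fun i => (N : ℤ) * α i) t = num α t ^ N := by
  unfold num
  rw [← Finset.prod_pow]
  refine Finset.prod_congr rfl fun i _ => ?_
  dsimp only
  rw [mul_comm, zpow_mul, zpow_natCast]

/-- `den σ (N·β) = (den σ β)^N`. -/
theorem den_ray (N : ℕ) (t : Fin ℓ → ℝ) : den σ (fun i => (N : ℤ) * β i) t = den σ β t ^ N := by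
  unfold den
  rw [← Finset.prod_pow]
  refine Finset.prod_congr rfl fun i _ => ?_
  dsimp only
  rw [mul_comm, zpow_mul, zpow_natCast]

/-- `f_σ(a,b) ω_σ = f_σ(a,b) · ω_σ`: `integrand σ a b t = rayF σ a b t * basic σ 0 t`. -/
theorem integrand_eq_rayF_mul (a b : Fin (ℓ + 3) → ℤ) (t : Fin ℓ → ℝ) :
    integrand σ a b t = rayF σ a b t * basic σ 0 t := by
  have h0 : num (fun _ : Fin (ℓ + 3) => (0 : ℤ)) t = 1 := by simp [num]
  have h0' : den σ (fun _ => (0 : ℤ)) t = 1 := by simp [den]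
  unfold basic rayF integrand
  rw [h0, h0']
  ring

/-- **`f_σ(Nα,Nβ) ω_σ = f_σ(α,β)^N · ω_σ`** pointwise:
`integrand σ (N·α) (N·β) t = rayF σ α β t ^ N * basic σ 0 t`. -/
theorem integrand_ray_eq (N : ℕ) (t : Fin ℓ → ℝ) :
    integrand σ (fun i => (N : ℤ) * α i) (fun i => (N : ℤ) * β i) t = rayF σ α β t ^ N * basic σ 0 t := by
  rw [integrand_eq_rayF_mul]
  unfold rayF
  rw [num_ray, den_ray, div_pow]

/-- `F > 0` on the open simplex (injective `σ`). -/
theorem rayF_pos (hσi : Function.Injective σ) {t : Fin ℓ → ℝ} (ht : t ∈ openSimplex ℓ) : 0 < rayF σ α β t := by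
  unfold rayF num den
  exact div_pos (Finset.prod_pos fun i _ => zpow_pos (ef_pos ht (succ_ne_self i)) _)
    (Finset.prod_pos fun i _ => zpow_pos (ef_pos ht fun e => succ_ne_self i (hσi e)) _)

/-- `F` is continuous on the open simplex (injective `σ`). -/
theorem continuousOn_rayF (hσi : Function.Injective σ) : ContinuousOn (rayF σ α β) (openSimplex ℓ) := by
  have hnum : ContinuousOn (fun t : Fin ℓ → ℝ => num α t) (openSimplex ℓ) := by
    refine continuousOn_finsetProd _ fun i _ => ?_
    exact ContinuousOn.zpow₀ (continuous_ef i (i + 1)).continuousOn _ fun t ht =>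
      Or.inl (ef_pos ht (succ_ne_self i)).ne'
  have hden : ContinuousOn (fun t : Fin ℓ → ℝ => den σ β t) (openSimplex ℓ) := by
    refine continuousOn_finsetProd _ fun i _ => ?_
    exact ContinuousOn.zpow₀ (continuous_ef (σ i) (σ (i + 1))).continuousOn _ fun t ht =>
      Or.inl (ef_pos ht fun e => succ_ne_self i (hσi e)).ne'
  exact hnum.div hden fun t ht =>
    (Finset.prod_pos fun i _ => zpow_pos (ef_pos ht fun e => succ_ne_self i (hσi e)) _).ne'

/-! ### The exponents of `F` on the cellular edge family -/

/-- The real exponents of `F = f_σ(α,β)` on the cellular edge family: `α_i` on the finite `δ⁰`-edges, `−β_i` on the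
finite `σδ⁰`-edges (so that `cellExp σ (Nα) (Nβ) = N · rayExp + cellExp σ 0 0`). -/
def rayExp : DEdge ℓ ⊕ SEdge σ → ℝ := Sum.elim (fun i => (α i.1 : ℝ)) (fun i => -(β i.1 : ℝ))

/-- `cellExp σ (N·α) (N·β) = N · rayExp + cellExp σ 0 0`. -/
theorem cellExp_ray (N : ℤ) :
    cellExp σ (fun i => N * α i) (fun i => N * β i) =
      fun e => (N : ℝ) * rayExp σ α β e + cellExp σ (fun _ => 0) (fun _ => 0) e := by
  funext e
  rcases e with i | i
  · simp [cellExp, rayExp]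
  · simp only [cellExp, rayExp, Sum.elim_inr]
    push_cast
    ring

/-- The block functional along the ray is affine in `N`:
`blockSum (cellExp σ (Nα) (Nβ)) L = N · Σ_{span ⊆ L} rayExp + blockSum (cellExp σ 0 0) L`. -/
theorem blockSum_ray (hσi : Function.Injective σ) (N : ℤ) (L : Finset (Fin (ℓ + 1))) :
    (cellEdges σ hσi).blockSum (cellExp σ (fun i => N * α i) (fun i => N * β i)) L =
      (N : ℝ) * (∑ e ∈ univ.filter (fun e => (cellEdges σ hσi).span e ⊆ L), rayExp σ α β e) +
        (cellEdges σ hσi).blockSum (cellExp σ (fun _ => 0) (fun _ => 0)) L := by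
  classical
  unfold EdgeFamily.blockSum
  rw [cellExp_ray, Finset.sum_add_distrib, Finset.mul_sum]
  ring

/-- On the open simplex, `F = powProd (rayExp)` for the cellular edge family. -/
theorem rayF_eq_powProd (hσi : Function.Injective σ) {t : Fin ℓ → ℝ} (ht : t ∈ openSimplex ℓ) :
    rayF σ α β t = (cellEdges σ hσi).powProd (rayExp σ α β) t := by
  have h1 := integrand_eq_powProd σ hσi (fun i => (1 : ℤ) * α i) (fun i => (1 : ℤ) * β i) ht
  have h0 := integrand_eq_powProd σ hσi (fun _ => (0 : ℤ)) (fun _ => (0 : ℤ)) ht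
  rw [cellExp_ray] at h1
  have hsplit : (cellEdges σ hσi).powProd
      (fun e => ((1 : ℤ) : ℝ) * rayExp σ α β e + cellExp σ (fun _ => 0) (fun _ => 0) e) t =
      (cellEdges σ hσi).powProd (rayExp σ α β) t *
        (cellEdges σ hσi).powProd (cellExp σ (fun _ => 0) (fun _ => 0)) t := by
    unfold EdgeFamily.powProd
    rw [← Finset.prod_mul_distrib]
    refine Finset.prod_congr rfl fun e _ => ?_
    dsimp only
    rw [Int.cast_one, one_mul, Real.rpow_add ((cellEdges σ hσi).len_pos ht e)]
  have hN1 : integrand σ (fun i => (1 : ℤ) * α i) (fun i => (1 : ℤ) * β i) t = rayF σ α β t * basic σ 0 t := by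
    have := integrand_ray_eq σ α β 1 t
    simpa using this
  have hb : basic σ 0 t = (cellEdges σ hσi).powProd (cellExp σ (fun _ => 0) (fun _ => 0)) t := h0
  have hbpos : 0 < basic σ 0 t := integrand_pos hσi _ _ ht
  rw [hN1, hsplit, ← hb] at h1
  exact mul_right_cancel₀ hbpos.ne' h1

/-! ### The whole ray in the convergence cone makes `F` bounded -/

section Ray

variable (hσ : Function.Bijective σ) (hh : Homogeneous σ α β)
  (hray : ∀ N : ℤ, 0 ≤ N → BrownConvergent σ (fun i => N * α i) (fun i => N * β i))

include hh in
/-- Homogeneity is inherited by every point of the ray. -/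
theorem homogeneous_ray (N : ℤ) : Homogeneous σ (fun i => N * α i) (fun i => N * β i) := by
  intro i
  have := hh i
  simp only
  rw [← mul_add, ← mul_add, this]

/-- `blockExp` of a singleton is `0` (no edge of `δ⁰` or of `σδ⁰` joins a vertex to itself). -/
theorem blockExp_singleton (hσi : Function.Injective σ) (a b : Fin (ℓ + 3) → ℤ) (v : Fin (ℓ + 3)) :
    blockExp σ a b {v} = 0 := by
  unfold blockExp aIn bIn
  have hA : (∑ i : Fin (ℓ + 3), if i ∈ ({v} : Finset (Fin (ℓ + 3))) ∧ i + 1 ∈ ({v} : Finset (Fin (ℓ + 3)))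
      then a i else 0) = 0 := by
    refine Finset.sum_eq_zero fun i _ => ?_
    rw [if_neg]
    simp only [Finset.mem_singleton, not_and]
    intro h1 h2
    exact succ_ne_self i (h1.trans h2.symm)
  have hB : (∑ i : Fin (ℓ + 3), if σ i ∈ ({v} : Finset (Fin (ℓ + 3))) ∧ σ (i + 1) ∈ ({v} : Finset (Fin (ℓ + 3)))
      then b i + 1 else 0) = 0 := by
    refine Finset.sum_eq_zero fun i _ => ?_
    rw [if_neg]
    simp only [Finset.mem_singleton, not_and]
    intro h1 h2
    exact succ_ne_self i (hσi (h1.trans h2.symm))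
  rw [hA, hB, Finset.card_singleton]
  simp

/-- The complement of the block of ALL finite points is the singleton `{∞}`. -/
theorem compl_vblock_all (ℓ : ℕ) : (vblock ℓ 0 (ℓ + 1))ᶜ = {Fin.last (ℓ + 2)} := by
  ext v
  rw [Finset.mem_compl, mem_vblock, Finset.mem_singleton]
  constructor
  · intro h
    apply Fin.ext
    rw [Fin.val_last]
    have := v.isLt
    omega
  · intro h
    rw [h, Fin.val_last]
    omega

include hh in
/-- **Homogeneity kills the full block**: for homogeneous exponents the block exponent of the set of all finite points
vanishes, hence `blockSum (cellExp σ a b)` of the full run of gaps is `0`. -/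
theorem blockSum_full_eq_zero : (cellEdges σ hσ.1).blockSum (cellExp σ α β) (gapRun ℓ 0 (ℓ + 1)) = 0 := by
  rw [blockSum_eq_blockExp σ α β hσ.1 (by omega) le_rfl]
  have h1 := twoOrdSet_eq_two_mul σ α β hσ hh (vblock ℓ 0 (ℓ + 1))
  have h2 := twoOrdSet_eq_two_mul σ α β hσ hh (vblock ℓ 0 (ℓ + 1))ᶜ
  rw [twoOrdSet_compl, h1, compl_vblock_all, blockExp_singleton σ hσ.1] at h2
  have : blockExp σ α β (vblock ℓ 0 (ℓ + 1)) = 0 := by linarith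
  rw [this]
  simp

include hh hray in
/-- **Every run of consecutive gaps carries a non-negative `F`-exponent sum** when the whole ray is in Brown's cone:
for proper runs by the block criterion at all `N` (Archimedes), for the full run by homogeneity (sum `= 0`). -/
theorem rayExpSum_nonneg_of_ray {p q : ℕ} (hpq : p < q) (hq : q ≤ ℓ + 1) :
    0 ≤ ∑ e ∈ univ.filter (fun e => (cellEdges σ hσ.1).span e ⊆ gapRun ℓ p q), rayExp σ α β e := by
  classical
  set X := ∑ e ∈ univ.filter (fun e => (cellEdges σ hσ.1).span e ⊆ gapRun ℓ p q), rayExp σ α β e with hX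
  set B := (cellEdges σ hσ.1).blockSum (cellExp σ (fun _ => 0) (fun _ => 0)) (gapRun ℓ p q) with hB
  by_cases hfull : q - p ≤ ℓ
  · -- proper run: `0 < N·X + B` for every `N ≥ 0`
    by_contra hneg
    rw [not_le] at hneg
    obtain ⟨N, hN⟩ := exists_nat_gt (B / (-X))
    have hc := crit_of_brownConvergent σ _ _ hσ (homogeneous_ray σ α β hh N) (hray N (Int.natCast_nonneg N))
      p q hpq hq hfull
    rw [blockSum_ray σ α β hσ.1, ← hX, ← hB, Int.cast_natCast] at hc
    have h1 : B < (N : ℝ) * (-X) := by rwa [div_lt_iff₀ (neg_pos.2 hneg)] at hN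
    linarith
  · -- the full run: the sum vanishes
    have hp0 : p = 0 := by omega
    have hq1 : q = ℓ + 1 := by omega
    subst hp0; subst hq1
    have h0 := blockSum_full_eq_zero σ (fun _ => (0 : ℤ)) (fun _ => (0 : ℤ)) hσ (homogeneous_const σ 0)
    have h1 := blockSum_full_eq_zero σ (fun i => (1 : ℤ) * α i) (fun i => (1 : ℤ) * β i) hσ
      (homogeneous_ray σ α β hh 1)
    rw [blockSum_ray σ α β hσ.1, ← hX, h0, Int.cast_one, one_mul, add_zero] at h1
    exact h1.symm.le

include hσ hh hray in
/-- **`F = f_σ(α,β)` is bounded on the open simplex** when the whole ray is in Brown's cone: `F ≤ Kup ℓ (rayExp)`. -/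
theorem rayF_le_Kup {t : Fin ℓ → ℝ} (ht : t ∈ openSimplex ℓ) :
    rayF σ α β t ≤ EdgeFamily.Kup ℓ (rayExp σ α β) := by
  rw [rayF_eq_powProd σ α β hσ.1 ht]
  refine (cellEdges σ hσ.1).powProd_le_Kup_of_runs (fun p q hpq hq => ?_) ht
  rw [← card_gapRun p q hq, (cellEdges σ hσ.1).card_le_blockSum_iff]
  exact rayExpSum_nonneg_of_ray σ α β hσ hh hray hpq hq

include hσ hh hray in
/-- The values of `F` on the simplex are bounded above. -/
theorem bddAbove_rayF_image : BddAbove (rayF σ α β '' openSimplex ℓ) :=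
  ⟨EdgeFamily.Kup ℓ (rayExp σ α β), by rintro _ ⟨t, ht, rfl⟩; exact rayF_le_Kup σ α β hσ hh hray ht⟩

include hσ hh hray in
/-- `F(t) ≤ M_σ(α,β)` on the open simplex. -/
theorem rayF_le_raySup {t : Fin ℓ → ℝ} (ht : t ∈ openSimplex ℓ) : rayF σ α β t ≤ raySup σ α β :=
  le_csSup (bddAbove_rayF_image σ α β hσ hh hray) ⟨t, ht, rfl⟩

include hσ hh hray in
/-- `0 < M_σ(α,β)`. -/
theorem raySup_pos : 0 < raySup σ α β := by
  obtain ⟨t, ht⟩ := openSimplex_nonempty ℓ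
  exact (rayF_pos σ α β hσ.1 ht).trans_le (rayF_le_raySup σ α β hσ hh hray ht)

include hσ hh hray in
/-- `M_σ(α,β) ≤ Kup ℓ (rayExp)` (an explicit, crude bound). -/
theorem raySup_le_Kup : raySup σ α β ≤ EdgeFamily.Kup ℓ (rayExp σ α β) :=
  csSup_le ((openSimplex_nonempty ℓ).image _) (by rintro _ ⟨t, ht, rfl⟩; exact rayF_le_Kup σ α β hσ hh hray ht)

/-! ### The integrals along the ray as moments of `ω_σ` -/

include hσ hh hray in
/-- `f_σ(α,β)^N ω_σ` is integrable on the open simplex for every `N ∈ ℕ`. -/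
theorem integrableOn_rayF_pow_mul (N : ℕ) :
    IntegrableOn (fun t => rayF σ α β t ^ N * basic σ 0 t) (openSimplex ℓ) := by
  have h := integrableOn_integrand_of_brownConvergent σ _ _ hσ (homogeneous_ray σ α β hh N)
    (hray N (Int.natCast_nonneg N))
  exact h.congr (ae_of_all _ fun t => integrand_ray_eq σ α β N t)

/-- The integral along the ray is the `N`-th moment of `ω_σ` against `F`. -/
theorem integral_ray_eq (N : ℕ) :
    integral σ (fun i => (N : ℤ) * α i) (fun i => (N : ℤ) * β i) =
      ∫ t in openSimplex ℓ, rayF σ α β t ^ N * basic σ 0 t := by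
  unfold integral
  exact integral_congr_ae (ae_of_all _ fun t => integrand_ray_eq σ α β N t)

/-! ### Growth along the ray -/

include hσ hh hray in
/-- **The growth constant of a cellular family along a convergent ray**:
`I_σ(Nα, Nβ)^{1/N} → M_σ(α,β) = sup_S f_σ(α,β)`. [Brown2016, §1.5, §5 objects; structural] -/
theorem tendsto_integral_ray_root :
    Tendsto (fun N : ℕ => (integral σ (fun i => (N : ℤ) * α i) (fun i => (N : ℤ) * β i)) ^ (1 / (N : ℝ)))
      atTop (𝓝 (raySup σ α β)) := by
  simp only [integral_ray_eq]
  exact Moment.tendsto_moment_root (isOpen_openSimplex ℓ) (continuousOn_rayF σ α β hσ.1)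
    (fun t ht => rayF_pos σ α β hσ.1 ht) (fun t ht => integrand_pos hσ.1 _ _ ht)
    (integrableOn_rayF_pow_mul σ α β hσ hh hray) (openSimplex_nonempty ℓ) (bddAbove_rayF_image σ α β hσ hh hray)

include hσ hh hray in
/-- Logarithmic form: `(log I_σ(Nα,Nβ))/N → log M_σ(α,β)`. -/
theorem tendsto_log_integral_ray_div :
    Tendsto (fun N : ℕ => Real.log (integral σ (fun i => (N : ℤ) * α i) (fun i => (N : ℤ) * β i)) / N)
      atTop (𝓝 (Real.log (raySup σ α β))) := by
  simp only [integral_ray_eq]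
  exact Moment.tendsto_log_moment_div (isOpen_openSimplex ℓ) (continuousOn_rayF σ α β hσ.1)
    (fun t ht => rayF_pos σ α β hσ.1 ht) (fun t ht => integrand_pos hσ.1 _ _ ht)
    (integrableOn_rayF_pow_mul σ α β hσ hh hray) (openSimplex_nonempty ℓ) (bddAbove_rayF_image σ α β hσ hh hray)

include hσ hh hray in
/-- `I_σ(Nα,Nβ) ≤ M_σ(α,β)^N · I_σ(0,0)`. -/
theorem integral_ray_le_raySup_pow (N : ℕ) :
    integral σ (fun i => (N : ℤ) * α i) (fun i => (N : ℤ) * β i) ≤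
      raySup σ α β ^ N * integral σ (fun i => ((0 : ℕ) : ℤ) * α i) (fun i => ((0 : ℕ) : ℤ) * β i) := by
  rw [integral_ray_eq, integral_ray_eq]
  exact Moment.moment_le_sup_pow (isOpen_openSimplex ℓ) (fun t ht => rayF_pos σ α β hσ.1 ht)
    (fun t ht => integrand_pos hσ.1 _ _ ht) (integrableOn_rayF_pow_mul σ α β hσ hh hray)
    (bddAbove_rayF_image σ α β hσ hh hray) N

include hσ hh hray in
/-- Log-convexity along the ray: `I(N+1)² ≤ I(N) · I(N+2)`. -/
theorem integral_ray_sq_le_mul (N : ℕ) :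
    integral σ (fun i => ((N + 1 : ℕ) : ℤ) * α i) (fun i => ((N + 1 : ℕ) : ℤ) * β i) ^ 2 ≤
      integral σ (fun i => (N : ℤ) * α i) (fun i => (N : ℤ) * β i) *
        integral σ (fun i => ((N + 2 : ℕ) : ℤ) * α i) (fun i => ((N + 2 : ℕ) : ℤ) * β i) := by
  rw [integral_ray_eq, integral_ray_eq, integral_ray_eq]
  exact Moment.moment_sq_le_mul (isOpen_openSimplex ℓ) (fun t ht => rayF_pos σ α β hσ.1 ht)
    (fun t ht => integrand_pos hσ.1 _ _ ht) (integrableOn_rayF_pow_mul σ α β hσ hh hray) (openSimplex_nonempty ℓ) N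

include hσ hh hray in
/-- The ratios `I(N+1)/I(N)` along the ray are non-decreasing. -/
theorem integral_ray_ratio_mono :
    Monotone fun N : ℕ => integral σ (fun i => ((N + 1 : ℕ) : ℤ) * α i) (fun i => ((N + 1 : ℕ) : ℤ) * β i) /
      integral σ (fun i => (N : ℤ) * α i) (fun i => (N : ℤ) * β i) := by
  simp only [integral_ray_eq]
  exact Moment.moment_ratio_mono (isOpen_openSimplex ℓ) (fun t ht => rayF_pos σ α β hσ.1 ht)
    (fun t ht => integrand_pos hσ.1 _ _ ht) (integrableOn_rayF_pow_mul σ α β hσ hh hray) (openSimplex_nonempty ℓ)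

include hσ hh hray in
/-- **Every ratio `I(N+1)/I(N)` is a lower bound for the growth constant `M_σ(α,β)`.** -/
theorem integral_ray_ratio_le_raySup (N : ℕ) :
    integral σ (fun i => ((N + 1 : ℕ) : ℤ) * α i) (fun i => ((N + 1 : ℕ) : ℤ) * β i) /
      integral σ (fun i => (N : ℤ) * α i) (fun i => (N : ℤ) * β i) ≤ raySup σ α β := by
  rw [integral_ray_eq, integral_ray_eq]
  exact Moment.moment_ratio_le_sup (isOpen_openSimplex ℓ) (fun t ht => rayF_pos σ α β hσ.1 ht)
    (fun t ht => integrand_pos hσ.1 _ _ ht) (integrableOn_rayF_pow_mul σ α β hσ hh hray) (openSimplex_nonempty ℓ)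
    (bddAbove_rayF_image σ α β hσ hh hray) N

include hσ hh hray in
/-- **The ratio limit along the ray**: `I(N+1)/I(N) → M_σ(α,β)`. -/
theorem tendsto_integral_ray_ratio :
    Tendsto (fun N : ℕ => integral σ (fun i => ((N + 1 : ℕ) : ℤ) * α i) (fun i => ((N + 1 : ℕ) : ℤ) * β i) /
      integral σ (fun i => (N : ℤ) * α i) (fun i => (N : ℤ) * β i)) atTop (𝓝 (raySup σ α β)) := by
  simp only [integral_ray_eq]
  exact Moment.tendsto_moment_ratio (isOpen_openSimplex ℓ) (continuousOn_rayF σ α β hσ.1)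
    (fun t ht => rayF_pos σ α β hσ.1 ht) (fun t ht => integrand_pos hσ.1 _ _ ht)
    (integrableOn_rayF_pow_mul σ α β hσ hh hray) (openSimplex_nonempty ℓ) (bddAbove_rayF_image σ α β hσ hh hray)

end Ray

end Summit.KontsevichZagierPeriods.Zeta5Search.Families.Cellular
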